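import Summits.CriticalPhenomena.PercolationContinuityZ3.Theorems.PercNearOneGluingAdditiveGluingMultiEdgeLemma3
import HarnessLib

/-! # Crux `PercNearOneGluing.AdditiveGluing` (stmt-CriticalPhenomena-4576) — the AL5 ladder: relay layers of a GLUED block

Support file (`--supports stmt-CriticalPhenomena-4576`; task png-dp-al5); no definitions, no named facts.

Setting (the lead's "averaged Lemma 5" AL5, LeadMath-c5 §J3).  `μ_w = prodBernoulli w` on the bond configurations of
the weighted complete graph `Fin n`, target `b`, `τ_w(v) = μ_w(v ↔ b)`.  A BLOCK is a vertex `x` (the bystander) together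
with a finite set `S` of further vertices; GLUING the block is the weighting
`w^S := fun e => if e ∈ S.image (s(x,·)) then 1 else w e` (the star `x–S` forced open, so that `x ↔ b` under `w^S` is
"`S ∪ {x} ↔ b`" and `d ↔ b` under `w^S` is "`d ↔ b` in the graph with the block contracted").  For a set `T` of relay
neighbours of `x` let `R = {ω | some edge s(x,a), a ∈ T, is open}`.  AL5 for the block reads

  `μ_{w^S}(R ∩ {d ↔ b}) ≤ μ_{w^S}(R ∩ {x ↔ b})`  whenever  `τ_w(d) ≤ τ_w(a)` for all `a ∈ T`   (hypothesis in the UN-glued `w`).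

For `S = ∅` this is the landed multi-edge Lemma 3 (`multiEdge_lemma3`, p174503).  This file proves, for EVERY block `S`:

* `al5_layer` — the single relay layer: `μ_{w^S}({s(x,a) open} ∩ {d ↔ b}) ≤ μ_{w^S}({s(x,a) open} ∩ {x ↔ b})` for each `a`
  with `τ_w(d) ≤ τ_w(a)` (iterated Kozma–Nitzan Lemma 5: glue `s(x,a)` at `a`, then the star at `x`; conditioning on an
  open edge is gluing it);
* `al5_singleRelay` — AL5 for every block when `T = {a}`; `al5_weighted` — the `|T|`-weighted AL5 for every block and `T`;
* `al5_of_blockDominates` — AL5 for every block when the glued block is at least as reliable as `d`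
  (`τ_{w^S}(d) ≤ τ_{w^S}(x)`; Kozma–Nitzan Lemma 3(i) in `w^S`, `R` being increasing in `C_x`);
* `al5_of_noGluedDrift` — AL5 for every block when `d` stays below `T` after gluing (`multiEdge_lemma3` in `w^S`).

The rungs `|S| = 1, 2` of the ladder (`al5_rung2`, `al5_rung3` counting the bystander) are these statements for
`S = {y}`, `S = {y, z}`; what is NOT covered here is the "glued drift" case (`τ_{w^S}(a) < τ_{w^S}(d)` for some `a ∈ T`
although `τ_w(d) ≤ τ_w(a)`, and `τ_{w^S}(x) < τ_{w^S}(d)`, and `|T| ≥ 2`).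
[cite: KozmaNitzan2024, Lemma 3(i) (pp. 6–7), Lemma 5 (p. 13)]
-/

namespace Summit.CriticalPhenomena.PercolationContinuityZ3.Theorems

open MeasureTheory Set
open Literature.Probability.LatticeModels (prodBernoulli)
open Literature.Probability.Percolation (BondConfig openConn openGraph openEdgeCluster pinW localCylinder)

noncomputable section
open Classical

section AL5Layers

open Filter Topology Literature.Probability.LatticeModels Literature.Probability.Percolation

variable {n : ℕ}

/-- Under a weighting giving the edge `x–v` weight `1`, `v` and `x` are equally likely to be joined to `b`.
[folklore] -/
theorem al5_real_openConn_eq_of_weight_one (p : Sym2 (Fin n) → unitInterval) {x v : Fin n} (b : Fin n)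
    (h1 : p s(x, v) = 1) (hvx : v ≠ x) :
    (prodBernoulli p).real (openConn v b) = (prodBernoulli p).real (openConn x b) := by
  have hae := prodBernoulli_ae_mem_of_eq_one p h1
  have heq : (openConn v b : Set (BondConfig (Fin n))) =ᵐ[prodBernoulli p]
      (openConn x b : Set (BondConfig (Fin n))) := by
    filter_upwards [hae] with ω hω
    have hadj : (openGraph ω).Adj x v := (openGraph_adj ω x v).2 ⟨hω, hvx.symm⟩
    exact propext ⟨fun h => hadj.reachable.trans h, fun h => hadj.symm.reachable.trans h⟩
  exact measureReal_congr heq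

/-- **Gluing one more edge at `x` keeps `c` below `x`** (Kozma–Nitzan Lemma 5 for the star `{s(y,x)}` at `y`
with leaf `x`): if `μ_w(c ↔ b) ≤ μ_w(x ↔ b)` then the same holds for the weighting with `s(x,y) ↦ 1`.
[cite: KozmaNitzan2024, Lemma 5 (p. 13)] -/
theorem al5_glue_edge (w : Sym2 (Fin n) → unitInterval) (x y c b : Fin n) (hyx : y ≠ x)
    (hle : (prodBernoulli w).real (openConn c b) ≤ (prodBernoulli w).real (openConn x b)) :
    (prodBernoulli (fun e : Sym2 (Fin n) => if e ∈ ({s(x, y)} : Finset (Sym2 (Fin n))) then 1 else w e)).real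
        (openConn c b) ≤
      (prodBernoulli (fun e : Sym2 (Fin n) => if e ∈ ({s(x, y)} : Finset (Sym2 (Fin n))) then 1 else w e)).real
        (openConn x b) := by
  have hD : ∀ e ∈ ({s(y, x)} : Finset (Sym2 (Fin n))), ∃ a, a ≠ y ∧ e = s(y, a) := by
    intro e he
    rw [Finset.mem_singleton] at he
    exact ⟨x, hyx.symm, he⟩
  have key := starGlue_lemma5 w y ({s(y, x)} : Finset (Sym2 (Fin n))) hD c x b (Finset.mem_singleton_self _)
    hyx.symm hle
  have hswap : ({s(y, x)} : Finset (Sym2 (Fin n))) = {s(x, y)} := by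
    rw [Sym2.eq_swap]
  rw [hswap] at key
  exact key

/-- **Gluing a star at `x` keeps `c` below `x`**: if `μ_w(c ↔ b) ≤ μ_w(x ↔ b)` then under the weighting with the star
`{s(x,y) : y ∈ S}` forced open still `μ(c ↔ b) ≤ μ(x ↔ b)` (induction on `S`, one edge at a time).
[cite: KozmaNitzan2024, Lemma 5 (p. 13)] -/
theorem al5_glue_star (S : Finset (Fin n)) :
    ∀ (w : Sym2 (Fin n) → unitInterval) (x c b : Fin n), (∀ y ∈ S, y ≠ x) →
      (prodBernoulli w).real (openConn c b) ≤ (prodBernoulli w).real (openConn x b) →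
      (prodBernoulli (fun e : Sym2 (Fin n) => if e ∈ S.image (fun y => s(x, y)) then 1 else w e)).real
          (openConn c b) ≤
        (prodBernoulli (fun e : Sym2 (Fin n) => if e ∈ S.image (fun y => s(x, y)) then 1 else w e)).real
          (openConn x b) := by
  induction S using Finset.induction_on with
  | empty =>
    intro w x c b _ hle
    have hw : (fun e : Sym2 (Fin n) =>
        if e ∈ (∅ : Finset (Fin n)).image (fun y => s(x, y)) then (1 : unitInterval) else w e) = w := by
      funext e
      simp only [Finset.image_empty, Finset.notMem_empty, if_false]
    rw [hw]
    exact hle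
  | insert y S hyS ih =>
    intro w x c b hS hle
    have hyx : y ≠ x := hS y (Finset.mem_insert_self y S)
    have hS' : ∀ y' ∈ S, y' ≠ x := fun y' hy' => hS y' (Finset.mem_insert_of_mem hy')
    have h1 := ih w x c b hS' hle
    have h2 := al5_glue_edge
      (fun e : Sym2 (Fin n) => if e ∈ S.image (fun y => s(x, y)) then 1 else w e) x y c b hyx h1
    have hw : (fun e : Sym2 (Fin n) =>
        if e ∈ (insert y S).image (fun y => s(x, y)) then (1 : unitInterval) else w e) =
        fun e : Sym2 (Fin n) => if e ∈ ({s(x, y)} : Finset (Sym2 (Fin n))) then 1 else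
          (if e ∈ S.image (fun y => s(x, y)) then 1 else w e) := by
      funext e
      rw [Finset.image_insert]
      by_cases he : e = s(x, y)
      · subst he
        simp only [Finset.mem_insert_self, if_true, Finset.mem_singleton]
      · simp only [Finset.mem_insert, he, false_or, Finset.mem_singleton, if_false]
    rw [hw]
    exact h2

/-- The glued-star weighting with one more edge `s(x,a)` glued, written in the two possible orders, is the same
weighting. [folklore] -/
theorem al5_glue_comm (w : Sym2 (Fin n) → unitInterval) (x a : Fin n) (S : Finset (Fin n)) :
    (fun e : Sym2 (Fin n) => if e ∈ ({s(x, a)} : Finset (Sym2 (Fin n))) then (1 : unitInterval) else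
        (if e ∈ S.image (fun y => s(x, y)) then 1 else w e)) =
      fun e : Sym2 (Fin n) => if e ∈ S.image (fun y => s(x, y)) then (1 : unitInterval) else
        (if e ∈ ({s(x, a)} : Finset (Sym2 (Fin n))) then 1 else w e) := by
  funext e
  by_cases h1 : e ∈ ({s(x, a)} : Finset (Sym2 (Fin n))) <;> by_cases h2 : e ∈ S.image (fun y => s(x, y)) <;>
    simp only [h1, h2, if_true, if_false]

/-- **AL5, one relay layer, every block** (`WIN ≥ LOSE` on the layer "edge `x–a` open"): if `τ_w(d) ≤ τ_w(a)`,
`a ≠ x`, then under the glued block `w^S` (star `x–S` forced open, `x ∉ S`)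
`μ_{w^S}({s(x,a) open} ∩ {d ↔ b}) ≤ μ_{w^S}({s(x,a) open} ∩ {x ↔ b})`.
Proof: conditioning on the open edge is gluing it (`gluingLemma5_real_inter_allOpen`); glue `s(x,a)` at `a`
(`starGlue_lemma5`: `d ≤ a ≡ x`), then the star at `x` (`al5_glue_star`).
[cite: KozmaNitzan2024, Lemma 5 (p. 13), §3.2 pp. 13–14] -/
theorem al5_layer (w : Sym2 (Fin n) → unitInterval) (S : Finset (Fin n)) (x d b a : Fin n)
    (hS : ∀ y ∈ S, y ≠ x) (hax : a ≠ x)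
    (hle : (prodBernoulli w).real (openConn d b) ≤ (prodBernoulli w).real (openConn a b)) :
    (prodBernoulli (fun e : Sym2 (Fin n) => if e ∈ S.image (fun y => s(x, y)) then 1 else w e)).real
        ({ω : Set (Sym2 (Fin n)) | s(x, a) ∈ ω} ∩ openConn d b) ≤
      (prodBernoulli (fun e : Sym2 (Fin n) => if e ∈ S.image (fun y => s(x, y)) then 1 else w e)).real
        ({ω : Set (Sym2 (Fin n)) | s(x, a) ∈ ω} ∩ openConn x b) := by
  set gS : Sym2 (Fin n) → unitInterval :=
    fun e => if e ∈ S.image (fun y => s(x, y)) then 1 else w e with hgS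
  set D₁ : Finset (Sym2 (Fin n)) := {s(x, a)} with hD₁
  set g₁ : Sym2 (Fin n) → unitInterval := fun e => if e ∈ D₁ then 1 else w e with hg₁
  set g₂ : Sym2 (Fin n) → unitInterval :=
    fun e => if e ∈ S.image (fun y => s(x, y)) then 1 else g₁ e with hg₂
  -- (1) glue `s(x,a)` at `a`: `d ≤ a ≡ x` under `g₁`
  have hD : ∀ e ∈ D₁, ∃ a', a' ≠ x ∧ e = s(x, a') := by
    intro e he
    rw [hD₁, Finset.mem_singleton] at he
    exact ⟨a, hax, he⟩
  have h1 : (prodBernoulli g₁).real (openConn d b) ≤ (prodBernoulli g₁).real (openConn a b) :=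
    starGlue_lemma5 w x D₁ hD d a b (by rw [hD₁]; exact Finset.mem_singleton_self _) hax hle
  have h1' : (prodBernoulli g₁).real (openConn a b) = (prodBernoulli g₁).real (openConn x b) :=
    al5_real_openConn_eq_of_weight_one g₁ b (by simp only [hg₁, hD₁, Finset.mem_singleton_self, if_true]) hax
  -- (2) glue the star at `x`
  have h2 : (prodBernoulli g₂).real (openConn d b) ≤ (prodBernoulli g₂).real (openConn x b) :=
    al5_glue_star S g₁ x d b hS (h1.trans_eq h1')
  -- (3) conditioning on `{s(x,a) open}` under `gS` is the weighting `g₂`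
  have hcyl : {ω : Set (Sym2 (Fin n)) | s(x, a) ∈ ω} = {ω | (↑D₁ : Set (Sym2 (Fin n))) ⊆ ω} := by
    ext ω
    simp only [Set.mem_setOf_eq, hD₁, Finset.coe_singleton, Set.singleton_subset_iff]
  have hpin : (fun e : Sym2 (Fin n) => if e ∈ D₁ then (1 : unitInterval) else gS e) = g₂ := by
    rw [hg₂, hg₁, hgS, hD₁]
    exact al5_glue_comm w x a S
  have hcond : ∀ v : Fin n, (prodBernoulli gS).real ({ω : Set (Sym2 (Fin n)) | s(x, a) ∈ ω} ∩ openConn v b) =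
      (prodBernoulli gS).real {ω : Set (Sym2 (Fin n)) | s(x, a) ∈ ω} * (prodBernoulli g₂).real (openConn v b) := by
    intro v
    rw [Set.inter_comm, hcyl, gluingLemma5_real_inter_allOpen gS D₁ MeasurableSet.of_discrete, hpin]
  rw [hcond d, hcond x]
  exact mul_le_mul_of_nonneg_left h2 measureReal_nonneg

/-- The event "some edge `s(x,a)`, `a ∈ T`, is open" (`x ∉ T`) is increasing in the open edge cluster of `x`.
[cite: VandenbergHaggstromKahn2005, §1 p. 3] -/
theorem al5_someOpen_mono (T : Finset (Fin n)) (x : Fin n) (hxT : x ∉ T) :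
    ∀ ω ω' : Set (Sym2 (Fin n)),
      ω ∈ {ω : Set (Sym2 (Fin n)) | ∃ a ∈ T, s(x, a) ∈ ω} →
        openEdgeCluster ω x ⊆ openEdgeCluster ω' x →
          ω' ∈ {ω : Set (Sym2 (Fin n)) | ∃ a ∈ T, s(x, a) ∈ ω} := by
  rintro ω ω' ⟨a, haT, hω⟩ hsub
  have hax : a ≠ x := fun h => hxT (h ▸ haT)
  refine ⟨a, haT, openEdgeCluster_subset ω' x (hsub ?_)⟩
  rw [mem_openEdgeCluster_iff]
  refine ⟨hω, fun h => hax (Sym2.mk_isDiag_iff.1 h).symm, fun y hy => ?_⟩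
  rcases Sym2.mem_iff.1 hy with rfl | rfl
  · exact SimpleGraph.Reachable.refl _
  · exact ((openGraph_adj ω x y).2 ⟨hω, hax.symm⟩).reachable

/-- **AL5 for every block when the glued block dominates `d`**: if `τ_{w^S}(d) ≤ τ_{w^S}(x)` then
`μ_{w^S}(R ∩ {d ↔ b}) ≤ μ_{w^S}(R ∩ {x ↔ b})`, `R` = some edge `x–T` open (`x ∉ T`).  This is Kozma–Nitzan's
Lemma 3(i) in the glued weighting (`R` is increasing in `C_x`); no hypothesis on `T` is needed.
[cite: KozmaNitzan2024, Lemma 3(i) (pp. 6–7)] -/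
theorem al5_of_blockDominates (w : Sym2 (Fin n) → unitInterval) (S T : Finset (Fin n)) (x d b : Fin n)
    (hxT : x ∉ T)
    (hle : (prodBernoulli (fun e : Sym2 (Fin n) => if e ∈ S.image (fun y => s(x, y)) then 1 else w e)).real
        (openConn d b) ≤
      (prodBernoulli (fun e : Sym2 (Fin n) => if e ∈ S.image (fun y => s(x, y)) then 1 else w e)).real
        (openConn x b)) :
    (prodBernoulli (fun e : Sym2 (Fin n) => if e ∈ S.image (fun y => s(x, y)) then 1 else w e)).real
        ({ω : Set (Sym2 (Fin n)) | ∃ a ∈ T, s(x, a) ∈ ω} ∩ openConn d b) ≤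
      (prodBernoulli (fun e : Sym2 (Fin n) => if e ∈ S.image (fun y => s(x, y)) then 1 else w e)).real
        ({ω : Set (Sym2 (Fin n)) | ∃ a ∈ T, s(x, a) ∈ ω} ∩ openConn x b) := by
  set gS : Sym2 (Fin n) → unitInterval :=
    fun e => if e ∈ S.image (fun y => s(x, y)) then 1 else w e with hgS
  have key := knLemma3i n gS d x b {ω : Set (Sym2 (Fin n)) | ∃ a ∈ T, s(x, a) ∈ ω} 0
    (al5_someOpen_mono T x hxT) le_rfl (by rw [add_zero]; exact hle)
  rw [zero_mul, add_zero] at key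
  rwa [Set.inter_comm _ (openConn d b), Set.inter_comm _ (openConn x b)]

/-- **AL5 for every block without glued drift**: if `d` is still below every `a ∈ T` under the glued block
(`τ_{w^S}(d) ≤ τ_{w^S}(a)`), then `μ_{w^S}(R ∩ {d ↔ b}) ≤ μ_{w^S}(R ∩ {x ↔ b})` — the multi-edge Lemma 3
(`multiEdge_lemma3`) applied to `w^S`. [cite: KozmaNitzan2024, Lemma 3(i) (pp. 6–7), Lemma 5 (p. 13)] -/
theorem al5_of_noGluedDrift (w : Sym2 (Fin n) → unitInterval) (S T : Finset (Fin n)) (x d b : Fin n)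
    (hxT : x ∉ T)
    (hle : ∀ a ∈ T,
      (prodBernoulli (fun e : Sym2 (Fin n) => if e ∈ S.image (fun y => s(x, y)) then 1 else w e)).real
          (openConn d b) ≤
        (prodBernoulli (fun e : Sym2 (Fin n) => if e ∈ S.image (fun y => s(x, y)) then 1 else w e)).real
          (openConn a b)) :
    (prodBernoulli (fun e : Sym2 (Fin n) => if e ∈ S.image (fun y => s(x, y)) then 1 else w e)).real
        ({ω : Set (Sym2 (Fin n)) | ∃ a ∈ T, s(x, a) ∈ ω} ∩ openConn d b) ≤
      (prodBernoulli (fun e : Sym2 (Fin n) => if e ∈ S.image (fun y => s(x, y)) then 1 else w e)).real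
        ({ω : Set (Sym2 (Fin n)) | ∃ a ∈ T, s(x, a) ∈ ω} ∩ openConn x b) :=
  multiEdge_lemma3 _ x d b T hxT hle

/-- **AL5 for every block with a single relay neighbour** (`T = {a}`, `a ≠ x`, hypothesis in the UN-glued `w`):
`μ_{w^S}({s(x,a) open} ∩ {d ↔ b}) ≤ μ_{w^S}({s(x,a) open} ∩ {x ↔ b})`, with `R` written for `T = {a}`.
[cite: KozmaNitzan2024, Lemma 5 (p. 13)] -/
theorem al5_singleRelay (w : Sym2 (Fin n) → unitInterval) (S : Finset (Fin n)) (x d b a : Fin n)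
    (hS : ∀ y ∈ S, y ≠ x) (hax : a ≠ x)
    (hle : (prodBernoulli w).real (openConn d b) ≤ (prodBernoulli w).real (openConn a b)) :
    (prodBernoulli (fun e : Sym2 (Fin n) => if e ∈ S.image (fun y => s(x, y)) then 1 else w e)).real
        ({ω : Set (Sym2 (Fin n)) | ∃ a' ∈ ({a} : Finset (Fin n)), s(x, a') ∈ ω} ∩ openConn d b) ≤
      (prodBernoulli (fun e : Sym2 (Fin n) => if e ∈ S.image (fun y => s(x, y)) then 1 else w e)).real
        ({ω : Set (Sym2 (Fin n)) | ∃ a' ∈ ({a} : Finset (Fin n)), s(x, a') ∈ ω} ∩ openConn x b) := by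
  have hR : {ω : Set (Sym2 (Fin n)) | ∃ a' ∈ ({a} : Finset (Fin n)), s(x, a') ∈ ω} =
      {ω : Set (Sym2 (Fin n)) | s(x, a) ∈ ω} := by
    ext ω
    simp only [Set.mem_setOf_eq, Finset.mem_singleton, exists_eq_left]
  rw [hR]
  exact al5_layer w S x d b a hS hax hle

/-- **Weighted AL5 for every block and every relay-neighbour set** (weights = number of open relay edges, layer by
layer): `∑_{a ∈ T} μ_{w^S}({s(x,a) open} ∩ {d ↔ b}) ≤ ∑_{a ∈ T} μ_{w^S}({s(x,a) open} ∩ {x ↔ b})` whenever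
`τ_w(d) ≤ τ_w(a)` for all `a ∈ T` (`x ∉ T`).  (LeadMath-c5 §J5: "the WEIGHTED averaged Lemma 5"; here for every
`|S|`.) [cite: KozmaNitzan2024, Lemma 5 (p. 13)] -/
theorem al5_weighted (w : Sym2 (Fin n) → unitInterval) (S T : Finset (Fin n)) (x d b : Fin n)
    (hS : ∀ y ∈ S, y ≠ x) (hxT : x ∉ T)
    (hle : ∀ a ∈ T, (prodBernoulli w).real (openConn d b) ≤ (prodBernoulli w).real (openConn a b)) :
    ∑ a ∈ T, (prodBernoulli (fun e : Sym2 (Fin n) => if e ∈ S.image (fun y => s(x, y)) then 1 else w e)).real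
        ({ω : Set (Sym2 (Fin n)) | s(x, a) ∈ ω} ∩ openConn d b) ≤
      ∑ a ∈ T, (prodBernoulli (fun e : Sym2 (Fin n) => if e ∈ S.image (fun y => s(x, y)) then 1 else w e)).real
        ({ω : Set (Sym2 (Fin n)) | s(x, a) ∈ ω} ∩ openConn x b) :=
  Finset.sum_le_sum fun a haT => al5_layer w S x d b a hS (fun h => hxT (h ▸ haT)) (hle a haT)

end AL5Layers

end

end Summit.CriticalPhenomena.PercolationContinuityZ3.Theorems
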